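import Mathlib.Analysis.SpecialFunctions.Complex.LogDeriv
import Mathlib.Analysis.SpecialFunctions.ExpDeriv
import Literature.Geometry.Kaehler.HolomorphicLineBundle
import HarnessLib

/-!
# Hermitian holomorphic line bundles from local potentials (`g_ij = exp f_ij`, `h_i = exp φ_i`)

Layer `Literature/Geometry/Kaehler`; support for the heart of Lefschetz's theorem on
`(1,1)`-classes (`Literature.AlgebraicGeometry.HodgeTheory.lefschetzOneOne_rational`, through the
predicate `ComplexDeRhamIsoFamily.IsLefschetzOneOne` of
`Literature/AlgebraicGeometry/HodgeTheory/LefschetzOneOneChernWeilReduction`). The printed proof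
(Voisin I, §3.3.1 with Thm. 7.10; equivalently the construction of the holomorphic line bundle
with prescribed curvature, Weil 1958 / Kostant 1970 — Griffiths–Harris p. 149) produces the line
bundle `L` and its Hermitian metric `h` in the following shape: an open cover `(U_i)`, real
functions `φ_i` smooth on `U_i` (the local potentials, `ω = (1/2iπ) ∂∂̄ φ_i` on `U_i`), holomorphic
functions `f_ij` on `U_i ∩ U_j` with `2 Re f_ij = φ_i − φ_j` there (pluriharmonic conjugates of the
differences of the potentials), whose exponentials `g_ij = exp f_ij` satisfy the cocycle condition
`g_ij g_jk = g_ik` on triple overlaps (the integrality of the class). This file PACKAGES such data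
into the carriers of `HolomorphicLineBundle.lean`:

* `HolomorphicLineBundle.ofExp` — the line bundle with `baseSet = U`, `coordChange i j = exp ∘ f_ij`
  (holomorphic and non-vanishing on `U_i ∩ U_j`; cocycle by hypothesis);
* `HolomorphicLineBundle.expMetric` — the Hermitian metric `h_i = exp φ_i` on it
  (`h_i = |g_ij|² h_j` is `exp φ_i = exp (2 Re f_ij) exp φ_j`);
* `HolomorphicLineBundle.localChernForm_expMetric` — its local Chern forms are
  `(1/4π) d((dφ_i) ∘ J)` (`log ∘ exp = id`), whence `isChernForm_expMetric`: a `2`-form `θ` which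
  on each `U_i` equals `(1/4π) d((dφ_i) ∘ J)` IS the Chern form of `(ofExp, expMetric)`.

Everything is proved; there are no named facts. (Voisin I, §3.3.1: "`h_i = |g_ij|² h_j` on
`U_i ∩ U_j`. The `2`-forms `ω_i = (1/2iπ) ∂∂̄ log h_i` […] provide a `2`-form `ω` on `X` […] called
the Chern form".)

## References

* C. Voisin, *Hodge Theory and Complex Algebraic Geometry I* (CUP 2002), §3.3.1, Thm. 4.49,
  Thm. 7.10.
* P. Griffiths, J. Harris, *Principles of Algebraic Geometry* (Wiley 1978), pp. 139–149
  (Hermitian line bundles, curvature, proof of the Lefschetz `(1,1)` theorem).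
-/

noncomputable section

open scoped Manifold ContDiff Topology
open Set

namespace Literature.Geometry.Kaehler

namespace HolomorphicLineBundle

variable {ι : Type*} {E : Type*} [NormedAddCommGroup E] [NormedSpace ℂ E]
  {M : Type*} [TopologicalSpace M] [ChartedSpace E M]

/-! ### The line bundle of an exponential cocycle -/

/-- **The holomorphic line bundle with transition functions `g_ij = exp f_ij`**: given an open
cover `(U_i)`, functions `f_ij` holomorphic on `U_i ∩ U_j`, and the cocycle condition
`exp f_ij · exp f_jk = exp f_ik` on `U_i ∩ U_j ∩ U_k`, the cocycle presentation of
`HolomorphicLineBundle` (Voisin I, §3.3.1 and Thm. 4.49: a `1`-cocycle of invertible holomorphic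
functions). [cite: VoisinHodgeI2002, §3.3.1 and Thm. 4.49] -/
def ofExp (U : ι → Set M) (hU : ∀ i, IsOpen (U i)) (hcov : ∀ x, ∃ i, x ∈ U i)
    (f : ι → ι → M → ℂ)
    (hf : ∀ i j, MDifferentiableOn 𝓘(ℂ, E) 𝓘(ℂ, ℂ) (f i j) (U i ∩ U j))
    (hcoc : ∀ i j k, ∀ x ∈ U i ∩ U j ∩ U k,
      Complex.exp (f i j x) * Complex.exp (f j k x) = Complex.exp (f i k x)) :
    HolomorphicLineBundle ι E M where
  baseSet := U
  isOpen_baseSet := hU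
  exists_mem_baseSet := hcov
  coordChange i j x := Complex.exp (f i j x)
  mdifferentiableOn_coordChange i j x hx :=
    Complex.differentiable_exp.comp_mdifferentiableWithinAt (hf i j x hx)
  coordChange_ne_zero _ _ _ _ := Complex.exp_ne_zero _
  coordChange_comp := hcoc

section

variable {U : ι → Set M} {hU : ∀ i, IsOpen (U i)} {hcov : ∀ x, ∃ i, x ∈ U i}
  {f : ι → ι → M → ℂ}
  {hf : ∀ i j, MDifferentiableOn 𝓘(ℂ, E) 𝓘(ℂ, ℂ) (f i j) (U i ∩ U j)}
  {hcoc : ∀ i j k, ∀ x ∈ U i ∩ U j ∩ U k,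
    Complex.exp (f i j x) * Complex.exp (f j k x) = Complex.exp (f i k x)}

/-- The base sets of `ofExp` are the given cover (definitional). [folklore] -/
@[simp]
theorem ofExp_baseSet (i : ι) : (ofExp U hU hcov f hf hcoc).baseSet i = U i :=
  rfl

/-- The transition functions of `ofExp` are `exp ∘ f_ij` (definitional). [folklore] -/
@[simp]
theorem ofExp_coordChange (i j : ι) (x : M) :
    (ofExp U hU hcov f hf hcoc).coordChange i j x = Complex.exp (f i j x) :=
  rfl

/-! ### The metric `h_i = exp φ_i` -/

/-- **The Hermitian metric `h_i = exp φ_i`** on the line bundle `ofExp U f`: for real functions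
`φ_i`, `C^∞` on `U_i` (for the real structure underlying the complex charts), with
`2 Re f_ij = φ_i − φ_j` on `U_i ∩ U_j`, the weights `exp φ_i` are positive, smooth on `U_i`, and
transform by `h_i = |g_ij|² h_j` since `|exp f_ij|² = exp (2 Re f_ij)` (Voisin I, §3.3.1).
[cite: VoisinHodgeI2002, §3.3.1] -/
def expMetric (φ : ι → M → ℝ) (hφ : ∀ i, ContMDiffOn 𝓘(ℝ, E) 𝓘(ℝ, ℝ) ∞ (φ i) (U i))
    (hre : ∀ i j, ∀ x ∈ U i ∩ U j, 2 * (f i j x).re = φ i x - φ j x) :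
    (ofExp U hU hcov f hf hcoc).HermitianMetric where
  weight i x := Real.exp (φ i x)
  weight_pos i x _ := Real.exp_pos _
  contMDiffOn_weight i x hx := Real.contDiff_exp.comp_contMDiffWithinAt (hφ i x hx)
  weight_eq i j x hx := by
    rw [ofExp_coordChange, Complex.norm_exp, ← Real.exp_nat_mul, ← Real.exp_add]
    congr 1
    have h := hre i j x hx
    push_cast
    linarith

variable {φ : ι → M → ℝ} {hφ : ∀ i, ContMDiffOn 𝓘(ℝ, E) 𝓘(ℝ, ℝ) ∞ (φ i) (U i)}
  {hre : ∀ i j, ∀ x ∈ U i ∩ U j, 2 * (f i j x).re = φ i x - φ j x}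

/-- The weights of `expMetric` are `exp φ_i` (definitional). [folklore] -/
@[simp]
theorem expMetric_weight (i : ι) (x : M) :
    (expMetric (hU := hU) (hcov := hcov) (hf := hf) (hcoc := hcoc) φ hφ hre).weight i x =
      Real.exp (φ i x) :=
  rfl

/-- **The local Chern forms of `(ofExp, expMetric)` are `(1/4π) d((dφ_i) ∘ J)`**
(`= (1/2iπ) ∂∂̄ φ_i`): `log h_i = log (exp φ_i) = φ_i`. [cite: VoisinHodgeI2002, §3.3.1] -/
theorem localChernForm_expMetric (i : ι) :
    (expMetric (hU := hU) (hcov := hcov) (hf := hf) (hcoc := hcoc) φ hφ hre).localChernForm i =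
      (1 / (4 * Real.pi)) •
        mextDeriv (mextDeriv (MForm.ofFun 𝓘(ℝ, E) fun x ↦ (φ i x : ℂ))).compJ := by
  rw [HermitianMetric.localChernForm]
  simp only [expMetric_weight, Real.log_exp]

/-- **A form which is `(1/4π) d((dφ_i) ∘ J)` on each `U_i` is the Chern form of
`(ofExp U f, h = exp φ)`** (the predicate `HermitianMetric.IsChernForm`; Voisin I, §3.3.1: the
`ω_i = (1/2iπ) ∂∂̄ log h_i` "provide a `2`-form `ω` on `X` […] called the Chern form").
[cite: VoisinHodgeI2002, §3.3.1] -/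
theorem isChernForm_expMetric {θ : MForm 𝓘(ℝ, E) M ℂ 2}
    (hθ : ∀ i, ∀ x ∈ U i, θ x =
      ((1 / (4 * Real.pi)) •
        mextDeriv (mextDeriv (MForm.ofFun 𝓘(ℝ, E) fun x ↦ (φ i x : ℂ))).compJ) x) :
    (expMetric (hU := hU) (hcov := hcov) (hf := hf) (hcoc := hcoc) φ hφ hre).IsChernForm θ := by
  intro i x hx
  rw [localChernForm_expMetric]
  exact hθ i x hx

end

/-- **Packaging for the heart of Lefschetz `(1,1)`**: from an open cover `(U_i)`, local real
potentials `φ_i` (smooth on `U_i`), holomorphic `f_ij` on `U_i ∩ U_j` with `2 Re f_ij = φ_i − φ_j`,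
and the cocycle condition for `exp f_ij`, every `2`-form `θ` which is `(1/4π) d((dφ_i) ∘ J)` on
each `U_i` is the Chern form of SOME Hermitian holomorphic line bundle presented by a cocycle
indexed by `ι` (namely `(ofExp U f, exp φ)`), in the shape consumed by
`ComplexDeRhamIsoFamily.IsLefschetzOneOne`. [cite: VoisinHodgeI2002, §3.3.1 and Thm. 7.10] -/
theorem exists_isChernForm_of_potentials (U : ι → Set M) (hU : ∀ i, IsOpen (U i))
    (hcov : ∀ x, ∃ i, x ∈ U i) (φ : ι → M → ℝ)
    (hφ : ∀ i, ContMDiffOn 𝓘(ℝ, E) 𝓘(ℝ, ℝ) ∞ (φ i) (U i)) (f : ι → ι → M → ℂ)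
    (hf : ∀ i j, MDifferentiableOn 𝓘(ℂ, E) 𝓘(ℂ, ℂ) (f i j) (U i ∩ U j))
    (hre : ∀ i j, ∀ x ∈ U i ∩ U j, 2 * (f i j x).re = φ i x - φ j x)
    (hcoc : ∀ i j k, ∀ x ∈ U i ∩ U j ∩ U k,
      Complex.exp (f i j x) * Complex.exp (f j k x) = Complex.exp (f i k x))
    {θ : MForm 𝓘(ℝ, E) M ℂ 2}
    (hθ : ∀ i, ∀ x ∈ U i, θ x =
      ((1 / (4 * Real.pi)) •
        mextDeriv (mextDeriv (MForm.ofFun 𝓘(ℝ, E) fun x ↦ (φ i x : ℂ))).compJ) x) :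
    ∃ (L : HolomorphicLineBundle ι E M) (h : L.HermitianMetric),
      L.baseSet = U ∧ h.IsChernForm θ :=
  ⟨ofExp U hU hcov f hf hcoc, expMetric φ hφ hre, rfl, isChernForm_expMetric hθ⟩

end HolomorphicLineBundle

/-! ### The cocycle condition from an integrality statement on the defects -/

/-- **Exponential cocycles from `2πi ℤ`-valued defects**: if `f_ij + f_jk − f_ik ∈ 2πi ℤ` at the
points of `U_i ∩ U_j ∩ U_k`, then `g_ij = exp f_ij` is a multiplicative cocycle (the form in which
the integrality of the class enters the construction of the line bundle; Griffiths–Harris p. 149).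
[cite: GriffithsHarris1978, p. 149] -/
theorem HolomorphicLineBundle.exp_mul_exp_eq_exp_of_exists_int {ι X : Type*} {U : ι → Set X}
    {f : ι → ι → X → ℂ}
    (h : ∀ i j k, ∀ x ∈ U i ∩ U j ∩ U k,
      ∃ n : ℤ, f i j x + f j k x - f i k x = n * (2 * Real.pi * Complex.I)) :
    ∀ i j k, ∀ x ∈ U i ∩ U j ∩ U k,
      Complex.exp (f i j x) * Complex.exp (f j k x) = Complex.exp (f i k x) := by
  intro i j k x hx
  obtain ⟨n, hn⟩ := h i j k x hx
  rw [← Complex.exp_add, Complex.exp_eq_exp_iff_exists_int]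
  exact ⟨n, by rw [← hn]; ring⟩

end Literature.Geometry.Kaehler

end
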